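import Summits.BirchSwinnertonDyer.Rank1Residual.X11b.Three.ImageSah
import Mathlib.GroupTheory.Index
import HarnessLib

/-!
# X11b at `p = 3` (team N8/O2, sub-target S7 · IMG3b, ADD-ON): `−1` survives in every normal
# subgroup of odd index — the Sah hypothesis passes up the anticyclotomic `ℤ₃`-tower (cell
# `b2b-bsdres`, team `x11b3`, seat p7; builds on p1's `Three/ImageSah.lean`)

HONEST FRAMING (verbatim, cell `b2b-bsdres`, run/shared/lean/b2b/bsd-rank1-residual/): the goal of
the cell is to DELETE the COMBINATION-SHAPED residual classes for ALL analytic-rank `≤ 1` curves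
over `ℚ` — "full BSD formula for every rank `≤ 1` curve in class `C`" assembled STRICTLY from
published theorems — so that the rank-`≤ 1` remainder becomes exactly the CONSTRUCTION-SHAPED
classes, which are TYPED (missing-input Props), NOT attempted; this is not "finishing BSD".
Research route (team N8/O2: STEP L at `3 ‖ N`); PURE GROUP THEORY; nothing booked; no label
touched; X11b@3 stays OPEN (RESIDUAL-MAP §I O2). THEOREMS ONLY; no definition; no fact; no `sorry`.

## Why (team lead's S7 hint, INBOX 2026-08-21T05:07Z; consumer S3 = control at `3`, p9)

`Three/ImageSah.lean` (p1, S7) kills `H¹(G, (ℤ/3^m)²)` and the `G`-fixed vectors as soon as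
`−1 ∈ G ≤ GL₂(ℤ/3^m)`. Along the anticyclotomic `ℤ₃`-tower `K ⊂ K₁ ⊂ ⋯ ⊂ K_∞` the relevant groups
are the images `G_n = ρ(G_{K_n}) ⊴ G_0 = ρ(G_K)`: NORMAL, of index a power of `3` (a quotient of
`Gal(K_n/K) ≅ ℤ/3^n`). An element with `z² = 1` of `G_0` maps to an element of order dividing
`gcd(2, [G_0 : G_n]) = 1` in `G_0/G_n`, so `−1 ∈ G_0 ⟹ −1 ∈ G_n`: the Sah hypothesis is inherited by
EVERY layer, hence "`E(K_n)[3^m]` has no non-zero Galois-fixed vector" and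
"`H¹(K_n(E[3^m])/K_n, E[3^m]) = 0`" at every layer `n`, GIVEN `−1 ∈ ρ_{E,3^m}(G_K)` (at `m = 1` on
X11b@3 with `K ≠ ℚ(√−3)`: `ρ̄(G_K) ⊇ SL₂(𝔽₃) ∋ −1`, team S6 `Three/ImageAtThree*.lean`; at level `3^m`:
e.g. tower surjectivity — NOT automatic, it stays the consumer's hypothesis).

* §1 `Subgroup.mem_of_sq_eq_one_of_odd_index` — `N ⊴ G`, `[G : N]` odd (finite), `z² = 1` ⟹ `z ∈ N`;
  `Subgroup.mem_of_sq_eq_one_of_index_eq_pow` — the same for `[G : N] = q^k`, `q` odd.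
* §2 matrices: `GL2.neg_one_mem_of_normal_of_odd_relIndex` — `N ≤ G ≤ GL_n(R)`, `N` normal in `G`
  of odd relative index, `−1 ∈ G` ⟹ `−1 ∈ N`; hence, with p1's `GL2.eq_zero_of_forall_mulVec_eq` /
  `GL2.exists_eq_mulVec_sub_of_crossedHom`: `GL2.eq_zero_of_forall_mulVec_eq_of_odd_relIndex`
  (no non-zero `N`-fixed vector in `(ℤ/3^m)²`) and
  `GL2.exists_eq_mulVec_sub_of_crossedHom_of_odd_relIndex` (crossed homomorphisms of `N` principal).

What this is NOT: no statement about elliptic curves (the consumer identifies `ρ(G_{K_n})` with `N`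
and `ρ(G_K)` with `G`, e.g. for the fixed-point hypotheses of the tree's
`controlMap_injective_of_fixedPoints_eq_bot` / `AcSelmer.localKer_eq_bot_of_fixedPoints_eq_bot`);
elementary; nothing booked.

References: C.-H. Sah, J. Algebra 10 (1968) Prop. 2.7 (b) [Sah1968]; team files
`cells/x11b3/PLAN.md` §2 S7, `cells/x11b3/LINE-K.md` K4; team lead INBOX 2026-08-21T05:07Z.
-/

namespace Summit.BirchSwinnertonDyer.Rank1Residual.X11b.Three

/-! ### §1. An involution lies in every normal subgroup of odd index -/

section Group

variable {G : Type*} [Group G]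

/-- **An element with `z² = 1` lies in every normal subgroup of odd (finite) index**: its image in
`G ⧸ N` has order dividing `2` and dividing `[G : N]`. [folklore] -/
theorem Subgroup.mem_of_sq_eq_one_of_odd_index (N : Subgroup G) [N.Normal] (hodd : Odd N.index)
    {z : G} (hz : z ^ 2 = 1) : z ∈ N := by
  rw [← QuotientGroup.eq_one_iff, ← orderOf_eq_one_iff]
  have h2 : orderOf (z : G ⧸ N) ∣ 2 :=
    orderOf_dvd_of_pow_eq_one (by rw [← QuotientGroup.mk_pow, hz, QuotientGroup.mk_one])
  have hI : orderOf (z : G ⧸ N) ∣ N.index := by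
    rw [Subgroup.index_eq_card]; exact orderOf_dvd_natCard _
  rcases (Nat.dvd_prime Nat.prime_two).mp h2 with h | h
  · exact h
  · exfalso
    rw [h] at hI
    exact (Nat.not_even_iff_odd.mpr hodd) (even_iff_two_dvd.mpr hI)

/-- The same for a normal subgroup of index `q ^ k` with `q` odd (the layers of a `ℤ_q`-tower,
`q = 3` for the team). [folklore] -/
theorem Subgroup.mem_of_sq_eq_one_of_index_eq_pow (N : Subgroup G) [N.Normal] {q k : ℕ}
    (hq : Odd q) (hidx : N.index = q ^ k) {z : G} (hz : z ^ 2 = 1) : z ∈ N :=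
  Subgroup.mem_of_sq_eq_one_of_odd_index N (by rw [hidx]; exact hq.pow) hz

end Group

/-! ### §2. Matrix groups: `−1` passes to normal subgroups of odd relative index -/

namespace GL2

open Matrix

section AnyRing

variable {n : Type*} [Fintype n] [DecidableEq n] {R : Type*} [CommRing R]

/-- **`−1` survives in every layer**: for subgroups `N, G ≤ GL_n(R)` with `N ∩ G` normal in `G` of odd
relative index (`N.relIndex G = [G : N ∩ G]`; intended use `N ≤ G`) and `−1 ∈ G`: `−1 ∈ N`
(`(−1)² = 1`). The images of `G_{K_n} ⊴ G_K` along a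
`ℤ₃`-tower have index a power of `3`. [folklore] -/
theorem neg_one_mem_of_normal_of_odd_relIndex (N G : Subgroup (GL n R))
    (hnorm : (N.subgroupOf G).Normal) (hodd : Odd (N.relIndex G)) (hG : (-1 : GL n R) ∈ G) :
    (-1 : GL n R) ∈ N := by
  have hmem : (⟨-1, hG⟩ : G) ∈ N.subgroupOf G :=
    Subgroup.mem_of_sq_eq_one_of_odd_index (N.subgroupOf G) hodd (Subtype.ext (by simp [sq]))
  rw [Subgroup.mem_subgroupOf] at hmem
  exact hmem

/-- Index-`3^k` form of `neg_one_mem_of_normal_of_odd_relIndex`. [folklore] -/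
theorem neg_one_mem_of_normal_of_relIndex_eq_three_pow (N G : Subgroup (GL n R))
    (hnorm : (N.subgroupOf G).Normal) {k : ℕ} (hidx : N.relIndex G = 3 ^ k)
    (hG : (-1 : GL n R) ∈ G) : (-1 : GL n R) ∈ N :=
  neg_one_mem_of_normal_of_odd_relIndex N G hnorm (by rw [hidx]; exact (by decide : Odd 3).pow) hG

end AnyRing

section ThreePow

variable {m : ℕ}

/-- **No non-zero `N`-fixed vector at any layer of the `3`-tower**: `N ≤ G ≤ GL₂(ℤ/3^m)`, `N`
normal in `G` of odd relative index (e.g. `3^k`), `−1 ∈ G` ⟹ a vector of `(ℤ/3^m)²` fixed by `N`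
is `0` (p1's `GL2.eq_zero_of_forall_mulVec_eq` at `N`, with `−1 ∈ N` from §1). The `p = 3` form of
"`E(K_n)[3^m]^{G_{K_n}} = 0` along the anticyclotomic tower, given `−1 ∈ ρ_{E,3^m}(G_K)`"; consumer:
the fixed-point hypotheses of the tree's anticyclotomic control-map lemmas (team S3). [folklore] -/
theorem eq_zero_of_forall_mulVec_eq_of_odd_relIndex (N G : Subgroup (GL (Fin 2) (ZMod (3 ^ m))))
    (hnorm : (N.subgroupOf G).Normal) (hodd : Odd (N.relIndex G))
    (hG : (-1 : GL (Fin 2) (ZMod (3 ^ m))) ∈ G) (v : Fin 2 → ZMod (3 ^ m))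
    (hv : ∀ g ∈ N,
      ((g : GL (Fin 2) (ZMod (3 ^ m))) : Matrix (Fin 2) (Fin 2) (ZMod (3 ^ m))) *ᵥ v = v) :
    v = 0 :=
  eq_zero_of_forall_mulVec_eq N (neg_one_mem_of_normal_of_odd_relIndex N G hnorm hodd hG) v hv

/-- **`H¹(N, (ℤ/3^m)²) = 0` at any layer of the `3`-tower**: `N ≤ G ≤ GL₂(ℤ/3^m)`, `N` normal in `G`
of odd relative index, `−1 ∈ G` ⟹ every crossed homomorphism `f : N → (ℤ/3^m)²`
(`f(gh) = g·f(h) + f(g)`) is principal (p1's `GL2.exists_eq_mulVec_sub_of_crossedHom` at `N`).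
[cite: Sah1968, Prop. 2.7 (b) and its proof, p. 60] -/
theorem exists_eq_mulVec_sub_of_crossedHom_of_odd_relIndex
    (N G : Subgroup (GL (Fin 2) (ZMod (3 ^ m)))) (hnorm : (N.subgroupOf G).Normal)
    (hodd : Odd (N.relIndex G)) (hG : (-1 : GL (Fin 2) (ZMod (3 ^ m))) ∈ G)
    (f : N → (Fin 2 → ZMod (3 ^ m)))
    (hf : ∀ g h : N, f (g * h) =
      ((g : GL (Fin 2) (ZMod (3 ^ m))) : Matrix (Fin 2) (Fin 2) (ZMod (3 ^ m))) *ᵥ f h + f g) :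
    ∃ a : Fin 2 → ZMod (3 ^ m), ∀ g : N,
      f g = ((g : GL (Fin 2) (ZMod (3 ^ m))) : Matrix (Fin 2) (Fin 2) (ZMod (3 ^ m))) *ᵥ a - a :=
  exists_eq_mulVec_sub_of_crossedHom N (neg_one_mem_of_normal_of_odd_relIndex N G hnorm hodd hG)
    f hf

end ThreePow

end GL2

end Summit.BirchSwinnertonDyer.Rank1Residual.X11b.Three
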